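import Summits.Ventures.PercRepro.Night2ThreeOneFatCells
import Summits.Ventures.PercRepro.Night2SeriesClassesThreeOneFSResidues

/-!
# PercRepro — **THE `(7, 5)` CELL `(3, 1)` IS CLOSED**: the shadow row modulo the residues T = `(2,0)`, `(2,1)`, `(3,2)`
(night-2, gen 24)

`localShadowHall_three_one_five_fat`: every rank-6 flat `G` of the cell `(3, 1)` (`|E ∖ G| = 3`, one coloop) with
`11 ≤ |G| ≤ 15`, a fat thin member and at most three fat thin closures (three forming a triangle) satisfies (LI_G):
one closure → the one-pair cell (`f = 1`); two closures → disjoint pairs (`[2, 2]`, `f = 2`) or meeting pairs (the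
triangle through series transitivity, `f = 2` by the injectivity of the closure on the covering preimages); three
closures → the triangle with `f = 2` by the parity lemma `card_fat_coverPreimages_le_two_of_triangle`.
With the residues S (`Night2SeriesClassesThreeOneFSResidues`) this removes the cell `(3, 1)` from the row:
**`shadowHall_seven_five_of_residuesT`** — `ShadowHall M 7 5 (phiK 7 5)` for every finite matroid modulo the
three cells `(2, 0)`, `(2, 1)`, `(3, 2)` of the regime `|E ∖ G| ≤ 3` (the cells with `c′ < 0`).
-/

namespace PercRepro.Shadow

open Finset PerFlat ThmH

variable {α : Type*} [DecidableEq α] {M : Matroid α} [M.Finite]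

/-- A 2-subset of `{p, x, y}` other than `{p, x}` and `{p, y}` is `{x, y}`. -/
theorem pair_eq_of_subset_triple {P : Finset α} {p x y : α} (hpx : p ≠ x) (hpy : p ≠ y) (hxy : x ≠ y)
    (hP : P.card = 2) (hsub : P ⊆ {p, x, y}) (h0 : P ≠ {p, x}) (h1 : P ≠ {p, y}) : P = {x, y} := by
  obtain ⟨a, b, hab, rfl⟩ := Finset.card_eq_two.1 hP
  have ha : a ∈ ({p, x, y} : Finset α) := hsub (by simp)
  have hb : b ∈ ({p, x, y} : Finset α) := hsub (by simp)
  simp only [Finset.mem_insert, Finset.mem_singleton] at ha hb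
  rcases ha with rfl | rfl | rfl <;> rcases hb with rfl | rfl | rfl
  · exact absurd rfl hab
  · exact absurd rfl h0
  · exact absurd rfl h1
  · exact absurd (Finset.pair_comm _ _) h0
  · exact absurd rfl hab
  · rfl
  · exact absurd (Finset.pair_comm _ _) h1
  · exact Finset.pair_comm _ _
  · exact absurd rfl hab

open scoped Classical in
/-- **THE CELL `(3, 1)` AT `11 ≤ |G| ≤ 15`** for every `G` with a fat thin member and at most three fat thin closures,
three of them forming a triangle. -/
theorem localShadowHall_three_one_five_fat {G : Finset α} (hG : G ∈ flatsQ M (5 + 1))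
    (hd : (gr M \ G).card = 3) (hk : kColoops M G = 1)
    (hs : ∀ e ∈ gr M, ∀ f ∈ gr M, e ≠ f → rkN M {e, f} = 2) (hl : ∀ e ∈ gr M, M.Indep {e})
    (hn1 : 11 ≤ G.card) (hn2 : G.card ≤ 15)
    (hfm : ∃ B ∈ thinMembers M 5 G, (G \ clF M B).card ≤ 2) (hcl : (fatClosures M 5 G 2).card ≤ 3)
    (htri : (fatClosures M 5 G 2).card = 3 →
      ∀ B₀ ∈ thinMembers M 5 G, ∀ B₁ ∈ thinMembers M 5 G, ∀ B₂ ∈ thinMembers M 5 G,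
        (G \ clF M B₀).card ≤ 2 → (G \ clF M B₁).card ≤ 2 → (G \ clF M B₂).card ≤ 2 →
        G \ clF M B₀ ≠ G \ clF M B₁ → G \ clF M B₀ ≠ G \ clF M B₂ → G \ clF M B₁ ≠ G \ clF M B₂ →
        ((G \ clF M B₀) ∪ (G \ clF M B₁) ∪ (G \ clF M B₂)).card ≤ 3) :
    LocalShadowHall M 5 G := by
  have hd' : (gr M \ G).card ≤ 5 := by omega
  have hc : ∀ {B : Finset α}, B ∈ thinMembers M 5 G → (G \ clF M B).card ≤ 2 → (G \ clF M B).card = 2 :=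
    fun hB hle => le_antisymm hle
      (two_le_card_sdiff_of_not_lay0 hG hd' (mem_thinMembers.1 hB).1 (mem_thinMembers.1 hB).2)
  have hpair : ∀ {B : Finset α}, B ∈ thinMembers M 5 G → (G \ clF M B).card ≤ 2 →
      ∃ p x : α, p ≠ x ∧ G \ clF M B = {p, x} ∧ (∀ a ∈ ({p, x} : Finset α), a ∉ coloops M G) ∧
        M.eRk ((G \ {p, x} : Finset α) : Set α) ≤ ((5 : ℕ) : ℕ∞) := by
    intro B hB hf
    obtain ⟨p, x, hpx, hP⟩ := Finset.card_eq_two.1 (hc hB hf)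
    refine ⟨p, x, hpx, hP, ?_, ?_⟩
    · intro a ha
      exact notMem_coloops_of_mem_sdiff_clF hG hd' hB (hP ▸ ha)
    · have := eRk_clF_le_of_mem_thinMembers hB
      rwa [clF_eq_sdiff_sdiff_of_thin hB, hP] at this
  have hmemG : ∀ {B : Finset α}, B ∈ thinMembers M 5 G → ∀ a ∈ G \ clF M B, a ∈ G :=
    fun _ a ha => (Finset.mem_sdiff.1 ha).1
  obtain ⟨B₀, hB₀, hf₀⟩ := hfm
  by_cases h1 : (fatClosures M 5 G 2).card ≤ 1
  · -- one fat closure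
    obtain ⟨p, x, hpx, -, hK, hH₀⟩ := hpair hB₀ hf₀
    exact localShadowHall_three_one_five_of_onePair_fat hG hd hk hs hl hn1 hn2 h1 hpx hK hH₀
  by_cases h2 : (fatClosures M 5 G 2).card ≤ 2
  · -- two fat closures
    obtain ⟨B₀, hB₀, B₁, hB₁, hf₀, hf₁, hne⟩ :=
      exists_twoFat_of_one_lt_card_fatClosures (M := M) (q := 5) (G := G) (by omega)
    have hfat2 : ∀ S ∈ shadowAt M (5 + 2) 5 (Uq M (5 + 2) 5) G, 5 + 1 ≤ (S \ coloops M G).card →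
        ((coverPreimages M (Uq M (5 + 2) 5) G S).filter
          (fun B => B ∉ lay0 M 5 G ∧ (G \ clF M B).card ≤ 2)).card ≤ 2 :=
      fun S _ _ => (card_fat_coverPreimages_le_card_fatClosures (q := 5) (G := G) (S := S) 2).trans h2
    by_cases hmeet : ((G \ clF M B₀) ∩ (G \ clF M B₁)).Nonempty
    · -- meeting pairs `{p, x}`, `{p, y}`: the triangle through series transitivity
      obtain ⟨p, hp⟩ := hmeet
      obtain ⟨x, y, hP₀, hP₁, hpx, hpy, hxy⟩ := pair_shape_of_mem_inter (hc hB₀ hf₀) (hc hB₁ hf₁) hne hp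
      have hpG : p ∈ G := hmemG hB₀ p (by rw [hP₀]; simp)
      have hxG : x ∈ G := hmemG hB₀ x (by rw [hP₀]; simp)
      have hyG : y ∈ G := hmemG hB₁ y (by rw [hP₁]; simp)
      have hpK : p ∉ coloops M G := notMem_coloops_of_mem_sdiff_clF hG hd' hB₀ (by rw [hP₀]; simp)
      have hxK : x ∉ coloops M G := notMem_coloops_of_mem_sdiff_clF hG hd' hB₀ (by rw [hP₀]; simp)
      have hyK : y ∉ coloops M G := notMem_coloops_of_mem_sdiff_clF hG hd' hB₁ (by rw [hP₁]; simp)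
      have hH₀ : M.eRk ((G \ {p, x} : Finset α) : Set α) ≤ ((5 : ℕ) : ℕ∞) := by
        have := eRk_clF_le_of_mem_thinMembers hB₀
        rwa [clF_eq_sdiff_sdiff_of_thin hB₀, hP₀] at this
      have hH₁ : M.eRk ((G \ {p, y} : Finset α) : Set α) ≤ ((5 : ℕ) : ℕ∞) := by
        have := eRk_clF_le_of_mem_thinMembers hB₁
        rwa [clF_eq_sdiff_sdiff_of_thin hB₁, hP₁] at this
      have hH₂ : M.eRk ((G \ {x, y} : Finset α) : Set α) ≤ ((5 : ℕ) : ℕ∞) :=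
        eRk_sdiff_pair_le_of_series' hG hH₀ hH₁
          (Finset.sdiff_sdiff_eq_self (Finset.insert_subset hpG (Finset.singleton_subset_iff.2 hxG)))
          (Finset.sdiff_sdiff_eq_self (Finset.insert_subset hpG (Finset.singleton_subset_iff.2 hyG))) hpx hpy hxy hpK
      refine localShadowHall_three_one_five_of_triangle_fat hG hd hk hs hl hn1 hn2 hfat2 hpx hpy hxy ?_ hH₀ hH₁ hH₂
      intro a ha
      simp only [Finset.mem_insert, Finset.mem_singleton] at ha
      rcases ha with rfl | rfl | rfl
      · exact hpK
      · exact hxK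
      · exact hyK
    · -- disjoint pairs
      rw [Finset.not_nonempty_iff_eq_empty] at hmeet
      obtain ⟨p, x, hpx, hP₀, hK₀, hH₀⟩ := hpair hB₀ hf₀
      obtain ⟨u, v, huv, hP₁, hK₁, hH₁⟩ := hpair hB₁ hf₁
      have hdisj : Disjoint ({p, x} : Finset α) {u, v} := by
        rw [← hP₀, ← hP₁]; exact Finset.disjoint_iff_inter_eq_empty.2 hmeet
      refine localShadowHall_three_one_five_of_twoDisjoint_fat hG hd hk hs hl hn1 hn2 h2 hpx huv hdisj ?_ hH₀ hH₁
      intro a ha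
      simp only [Finset.mem_insert, Finset.mem_singleton] at ha
      rcases ha with rfl | rfl | rfl | rfl
      · exact hK₀ _ (by simp)
      · exact hK₀ _ (by simp)
      · exact hK₁ _ (by simp)
      · exact hK₁ _ (by simp)
  · -- three fat closures: the triangle
    have h3 : (fatClosures M 5 G 2).card = 3 := by omega
    have htri' := htri h3
    obtain ⟨B₀, hB₀, B₁, hB₁, B₂, hB₂, hf₀, hf₁, hf₂, h01, h02, h12⟩ :=
      exists_threeFat_of_two_lt_card_fatClosures (M := M) (q := 5) (G := G) (by omega)
    have hU := htri' B₀ hB₀ B₁ hB₁ B₂ hB₂ hf₀ hf₁ hf₂ h01 h02 h12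
    -- two of the three pairs share a point
    have hmeet : ((G \ clF M B₀) ∩ (G \ clF M B₁)).Nonempty := by
      by_contra hdis
      rw [Finset.not_nonempty_iff_eq_empty] at hdis
      have hcu : ((G \ clF M B₀) ∪ (G \ clF M B₁)).card = 4 := by
        rw [Finset.card_union_of_disjoint (Finset.disjoint_iff_inter_eq_empty.2 hdis), hc hB₀ hf₀, hc hB₁ hf₁]
      have := Finset.card_le_card (Finset.subset_union_left (s₁ := (G \ clF M B₀) ∪ (G \ clF M B₁))
        (s₂ := G \ clF M B₂))
      omega
    obtain ⟨p, hp⟩ := hmeet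
    obtain ⟨x, y, hP₀, hP₁, hpx, hpy, hxy⟩ := pair_shape_of_mem_inter (hc hB₀ hf₀) (hc hB₁ hf₁) h01 hp
    -- the third pair is `{x, y}`
    have hP₂ : G \ clF M B₂ = {x, y} := by
      have h3c : ({p, x, y} : Finset α).card = 3 := by
        rw [Finset.card_insert_of_notMem (by simp [hpx, hpy]), Finset.card_pair hxy]
      have hU' : ({p, x, y} : Finset α) = (G \ clF M B₀) ∪ (G \ clF M B₁) ∪ (G \ clF M B₂) := by
        apply Finset.eq_of_subset_of_card_le
        · rw [hP₀, hP₁]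
          intro z hz
          simp only [Finset.mem_union, Finset.mem_insert, Finset.mem_singleton] at hz ⊢
          tauto
        · rw [h3c]; exact hU
      refine pair_eq_of_subset_triple hpx hpy hxy (hc hB₂ hf₂) ?_ (hP₀ ▸ h02.symm) (hP₁ ▸ h12.symm)
      rw [hU']
      exact Finset.subset_union_right
    -- every fat thin closure is one of the three
    have hall : ∀ B ∈ thinMembers M 5 G, (G \ clF M B).card ≤ 2 →
        G \ clF M B = {p, x} ∨ G \ clF M B = {p, y} ∨ G \ clF M B = {x, y} := by
      intro B hB hf
      have hsub : ({clF M B₀, clF M B₁, clF M B₂} : Finset (Finset α)) ⊆ fatClosures M 5 G 2 := by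
        intro C hC
        simp only [Finset.mem_insert, Finset.mem_singleton] at hC
        unfold fatClosures
        rw [Finset.mem_image]
        rcases hC with rfl | rfl | rfl
        · exact ⟨B₀, Finset.mem_filter.2 ⟨hB₀, hf₀⟩, rfl⟩
        · exact ⟨B₁, Finset.mem_filter.2 ⟨hB₁, hf₁⟩, rfl⟩
        · exact ⟨B₂, Finset.mem_filter.2 ⟨hB₂, hf₂⟩, rfl⟩
      have hne01 : clF M B₀ ≠ clF M B₁ := fun h => h01 (by rw [h])
      have hne02 : clF M B₀ ≠ clF M B₂ := fun h => h02 (by rw [h])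
      have hne12 : clF M B₁ ≠ clF M B₂ := fun h => h12 (by rw [h])
      have hcard3 : ({clF M B₀, clF M B₁, clF M B₂} : Finset (Finset α)).card = 3 := by
        rw [Finset.card_insert_of_notMem (by simp [hne01, hne02]), Finset.card_pair hne12]
      have heq := Finset.eq_of_subset_of_card_le hsub (by omega)
      have hBin : clF M B ∈ fatClosures M 5 G 2 := by
        unfold fatClosures
        rw [Finset.mem_image]
        exact ⟨B, Finset.mem_filter.2 ⟨hB, hf⟩, rfl⟩
      rw [← heq] at hBin
      simp only [Finset.mem_insert, Finset.mem_singleton] at hBin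
      rcases hBin with h | h | h
      · left; rw [h]; exact hP₀
      · right; left; rw [h]; exact hP₁
      · right; right; rw [h]; exact hP₂
    have hfat2 : ∀ S ∈ shadowAt M (5 + 2) 5 (Uq M (5 + 2) 5) G, 5 + 1 ≤ (S \ coloops M G).card →
        ((coverPreimages M (Uq M (5 + 2) 5) G S).filter
          (fun B => B ∉ lay0 M 5 G ∧ (G \ clF M B).card ≤ 2)).card ≤ 2 :=
      fun S hS _ => card_fat_coverPreimages_le_two_of_triangle (subset_G_of_mem_shadowAt hS) hpx hpy hxy hall
    have hpK : p ∉ coloops M G := notMem_coloops_of_mem_sdiff_clF hG hd' hB₀ (by rw [hP₀]; simp)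
    have hxK : x ∉ coloops M G := notMem_coloops_of_mem_sdiff_clF hG hd' hB₀ (by rw [hP₀]; simp)
    have hyK : y ∉ coloops M G := notMem_coloops_of_mem_sdiff_clF hG hd' hB₁ (by rw [hP₁]; simp)
    have hH₀ : M.eRk ((G \ {p, x} : Finset α) : Set α) ≤ ((5 : ℕ) : ℕ∞) := by
      have := eRk_clF_le_of_mem_thinMembers hB₀
      rwa [clF_eq_sdiff_sdiff_of_thin hB₀, hP₀] at this
    have hH₁ : M.eRk ((G \ {p, y} : Finset α) : Set α) ≤ ((5 : ℕ) : ℕ∞) := by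
      have := eRk_clF_le_of_mem_thinMembers hB₁
      rwa [clF_eq_sdiff_sdiff_of_thin hB₁, hP₁] at this
    have hH₂ : M.eRk ((G \ {x, y} : Finset α) : Set α) ≤ ((5 : ℕ) : ℕ∞) := by
      have := eRk_clF_le_of_mem_thinMembers hB₂
      rwa [clF_eq_sdiff_sdiff_of_thin hB₂, hP₂] at this
    refine localShadowHall_three_one_five_of_triangle_fat hG hd hk hs hl hn1 hn2 hfat2 hpx hpy hxy ?_ hH₀ hH₁ hH₂
    intro a ha
    simp only [Finset.mem_insert, Finset.mem_singleton] at ha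
    rcases ha with rfl | rfl | rfl
    · exact hpK
    · exact hxK
    · exact hyK

section SevenFiveT

variable {α' : Type} [DecidableEq α']

/-- **THE `(7, 5)` SHADOW ROW FOR EVERY FINITE MATROID MODULO THE RESIDUES T**: the cells `(2, 0)`, `(2, 1)` and
`(3, 2)` — the cell `(3, 1)` is gone. -/
theorem shadowHall_seven_five_of_residuesT
    (h20 : ∀ (N : Matroid α') [N.Finite] (G : Finset α'), CellHyp N G →
      (gr N \ G).card = 2 → kColoops N G = 0 → FatMember N G 6 3 →
      (FatBasis N G 6 2 ∨ FatMember N G 6 2) → LocalShadowHall N 5 G)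
    (h21 : ∀ (N : Matroid α') [N.Finite] (G : Finset α'), CellHyp N G →
      (gr N \ G).card = 2 → kColoops N G = 1 → FatMember N G 5 4 →
      (FatBasis N G 5 3 ∨ FatMember N G 5 3) → LocalShadowHall N 5 G)
    (h32 : ∀ (N : Matroid α') [N.Finite] (G : Finset α'), CellHyp N G →
      (gr N \ G).card = 3 → kColoops N G = 2 → FatMember N G 4 2 → LocalShadowHall N 5 G)
    (M : Matroid α') [M.Finite] : ShadowHall M 7 5 (phiK 7 5) := by
  apply shadowHall_seven_five_of_residuesS h20 h21 _ h32
  intro N _ G hcell hd hk h11 h15 hfm _ _ _ hc3 hc11 hc1214 hc15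
  obtain ⟨B₀, hB₀, -, hf₀⟩ := hfm
  refine localShadowHall_three_one_five_fat hcell.2.2.2 hd hk hcell.1 hcell.2.1 h11 h15 ⟨B₀, hB₀, hf₀⟩ hc3 ?_
  intro h3
  have hmid : 12 ≤ G.card ∧ G.card ≤ 14 := by
    rcases (show G.card = 11 ∨ G.card = 15 ∨ (12 ≤ G.card ∧ G.card ≤ 14) by omega) with h | h | h
    · have := hc11 h; omega
    · have := hc15 h; omega
    · exact h
  exact hc1214 hmid

end SevenFiveT

end PercRepro.Shadow
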